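import Literature.AlgebraicGeometry.HodgeTheory.UnitaryReflectionLieProjector
import HarnessLib

/-!
# Unitary reflection groups along one orbit of roots: a non-zero `Ad(Γ)`-stable space of traceless
# endomorphisms contains a nilpotent, and `W` is irreducible under it (Carlson–Toledo 1999 §7, Theorem
# `udensitytheo` — algebraic proof, part 2)

Family `hodge`, layer `Literature/AlgebraicGeometry/HodgeTheory`. THEOREMS only (no definition, no named
fact). Sequel of `UnitaryReflectionLieProjector` (root projectors `π_δ = ε • (B δ).smulRight δ`, component
closure `offDiag_mem_of_conj_mem`, `Γ`-irreducibility `eq_bot_or_eq_top_of_forall_map_mem`), second part of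
the ALGEBRAIC proof of Carlson–Toledo's density theorem for unitary reflection groups (named fact
`carlsonToledo1999_unitaryReflection_zariskiDense`): for a reflection system — `B` right-separating
sesquilinear on the complex space `W`, roots `δ ∈ Δ` with `B δ δ = ε`, `ε² = 1`, spanning `W`,
`Γ ≤ GL(W)` generated by the `λ`-reflections `s_δ = complexReflection B ε λ δ` and transitive on `Δ`,
`λ ∉ {0, 1, -1}` — and a subspace `L ⊆ End(W)` stable under `Ad(γ) : Y ↦ γ Y γ⁻¹`, `γ ∈ Γ`:

* `exists_sq_eq_zero_mem` — if `L ≠ 0` consists of TRACELESS endomorphisms, it contains a non-zero `N`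
  with `N² = 0`: otherwise, by component closure, every `Y ∈ L` commutes with every `π_δ`, hence with the
  generators of `Γ`, hence with `Γ`; by Schur's lemma (`W` is `Γ`-irreducible, `ℂ` algebraically closed)
  `Y` is a scalar, traceless, so `Y = 0`;
* `eq_bot_or_eq_top_of_forall_mem_map_mem` — **`W` is `L`-irreducible** as soon as `L` contains a
  non-zero square-zero `N`: take an `L`-stable `S ≠ 0` of minimal dimension; if `dim S ≥ 2` then for every
  root the `L`-stable `S ∩ s_δ S` contains `S ∩ δ^⊥ ≠ 0`, so `s_δ S = S` by minimality, `S` is `Γ`-stable,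
  `S = W`; if `dim S = 1`, `S = ℂw`, every `γ w` spans an `L`-stable line, so `N(γ w) ∈ ℂ γ w` forces
  `N(γ w) = 0` on the orbit of `w`, which spans `W` — contradiction.

Written by the prover seat `hodge-nonav-prover-Bx` (cell `hodge-nonav`) for crux K1
`VeryGeneralDeckCommutatorsInHg` of `Summits/HodgeConjecture/HodgeConjecture/Theses/CyclicUnitaryPowers.lean`
(`stmt-HodgeConjecture-19544`).

## References
* [CarlsonToledo1999] J. A. Carlson, D. Toledo, *Discriminant complements and kernels of monodromy
  representations*, Duke Math. J. 97 (1999) 621–648, §7 Theorem `udensitytheo` (arXiv alg-geom/9708002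
  p. 15), formula (reflectionconjugacy).
* [Deligne1980] P. Deligne, *La conjecture de Weil. II*, Publ. Math. IHÉS 52 (1980), §4.4.
-/

noncomputable section

open Module

namespace Literature.AlgebraicGeometry.HodgeTheory

/-! ### §1 A non-zero `Ad(Γ)`-stable space of traceless endomorphisms contains a nilpotent -/

section Nilpotent

variable {W : Type*} [AddCommGroup W] [Module ℂ W] [FiniteDimensional ℂ W]

/-- **A non-zero `Ad(Γ)`-stable space of traceless endomorphisms contains a non-zero square-zero
element** (for a reflection system with `λ ∉ {0, ±1}`): by component closure, if no off-diagonal block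
`π_δ Y (1-π_δ)`, `(1-π_δ) Y π_δ` (`δ ∈ Δ`, `Y ∈ L`) is non-zero, every `Y ∈ L` commutes with every `π_δ`,
hence with the generators of `Γ`, hence with `Γ`; by Schur's lemma (`W` is `Γ`-irreducible) `Y` is a
scalar, and traceless, so `Y = 0`. [cite: CarlsonToledo1999, §7 Theorem udensitytheo] -/
theorem exists_sq_eq_zero_mem {B : W →ₗ⋆[ℂ] W →ₗ[ℂ] ℂ} (hBr : B.SeparatingRight) {ε : ℂ}
    (hε : ε * ε = 1) {l : ℂ} (hl0 : l ≠ 0) (hl1 : l ≠ 1) (hl2 : l * l ≠ 1) {Δ : Set W}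
    (hΔ : ∀ δ ∈ Δ, B δ δ = ε) (hspan : Submodule.span ℂ Δ = ⊤) {Γ : Subgroup (W ≃ₗ[ℂ] W)}
    (hΓ : Γ = Subgroup.closure {g : W ≃ₗ[ℂ] W | ∃ δ ∈ Δ, (g : W →ₗ[ℂ] W) = complexReflection B ε l δ})
    (htrans : ∀ δ ∈ Δ, ∀ δ' ∈ Δ, ∃ g ∈ Γ, g δ = δ') {L : Submodule ℂ (Module.End ℂ W)} (hL0 : L ≠ ⊥)
    (htr : ∀ Y ∈ L, LinearMap.trace ℂ W Y = 0)
    (hAd : ∀ g ∈ Γ, ∀ Y ∈ L, (g : Module.End ℂ W) * Y * ((g⁻¹ : W ≃ₗ[ℂ] W) : Module.End ℂ W) ∈ L) :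
    ∃ N ∈ L, N ≠ 0 ∧ N * N = 0 := by
  classical
  have hε0 : ε ≠ 0 := by rintro rfl; norm_num at hε
  have hgen : ∀ δ ∈ Δ, ∃ g ∈ Γ, (g : W →ₗ[ℂ] W) = complexReflection B ε l δ := fun δ hδ =>
    ⟨complexReflectionEquiv B hε hl0 (hΔ δ hδ), hΓ ▸ Subgroup.subset_closure ⟨δ, hδ, rfl⟩, rfl⟩
  by_contra hno
  push Not at hno
  -- every off-diagonal block vanishes
  have hoff : ∀ δ ∈ Δ, ∀ Y ∈ L, (ε • (B δ).smulRight δ) * Y * (1 - ε • (B δ).smulRight δ) = 0 ∧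
      (1 - ε • (B δ).smulRight δ) * Y * (ε • (B δ).smulRight δ) = 0 := by
    intro δ hδ Y hY
    have hπ := rootProj_mul_self B hε (hΔ δ hδ)
    obtain ⟨g, hgΓ, hg⟩ := hgen δ hδ
    have hconj : ∀ Z ∈ L, (1 + (l - 1) • (ε • (B δ).smulRight δ)) * Z *
        (1 + (l⁻¹ - 1) • (ε • (B δ).smulRight δ)) ∈ L := by
      intro Z hZ
      have h := hAd g hgΓ Z hZ
      have hg' : (g : Module.End ℂ W) = 1 + (l - 1) • (ε • (B δ).smulRight δ) := by
        rw [← complexReflection_eq_one_add_smul_rootProj, ← hg]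
      rwa [hg', coe_inv_eq_one_add_smul_rootProj B hε hl0 (hΔ δ hδ) hg] at h
    obtain ⟨haL, hbL⟩ := offDiag_mem_of_conj_mem hπ hl0 hl1 hl2 hconj hY
    obtain ⟨haa, hbb⟩ := offDiag_mul_self hπ Y
    exact ⟨by_contra (fun h => hno _ haL h haa), by_contra (fun h => hno _ hbL h hbb)⟩
  -- hence every `Y ∈ L` commutes with `Γ`
  have hcommπ : ∀ δ ∈ Δ, ∀ Y ∈ L, (ε • (B δ).smulRight δ) * Y = Y * (ε • (B δ).smulRight δ) :=
    fun δ hδ Y hY => commute_of_offDiag_eq_zero (hoff δ hδ Y hY).1 (hoff δ hδ Y hY).2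
  have hcommΓ : ∀ Y ∈ L, ∀ g ∈ Γ, ∀ x, g (Y x) = Y (g x) := by
    intro Y hY g hg
    rw [hΓ] at hg
    induction hg using Subgroup.closure_induction with
    | mem g hg =>
      obtain ⟨δ, hδ, hgδ⟩ := hg
      intro x
      have hc := hcommπ δ hδ Y hY
      have h1 : (g : Module.End ℂ W) * Y = Y * (g : Module.End ℂ W) := by
        have hg' : (g : Module.End ℂ W) = 1 + (l - 1) • (ε • (B δ).smulRight δ) := by
          rw [← complexReflection_eq_one_add_smul_rootProj, ← hgδ]
        rw [hg', add_mul, mul_add, one_mul, mul_one, smul_mul_assoc, mul_smul_comm, hc]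
      simpa using congrArg (fun f : Module.End ℂ W => f x) h1
    | one => intro x; rfl
    | mul g h _ _ hg hh => intro x; rw [LinearEquiv.mul_apply, hh, hg, LinearEquiv.mul_apply]
    | inv g _ hg =>
      intro x
      apply g.injective
      rw [linearEquiv_apply_inv_apply, hg, linearEquiv_apply_inv_apply]
  -- Schur: every `Y ∈ L` is a traceless scalar, i.e. `0`
  apply hL0
  rw [Submodule.eq_bot_iff]
  intro Y hY
  rcases subsingleton_or_nontrivial W with hW | hW
  · ext x; simp [Subsingleton.elim x 0]
  obtain ⟨c, hc⟩ := Module.End.exists_eigenvalue Y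
  have hE : Y.eigenspace c = ⊤ := by
    have hstabE : ∀ g ∈ Γ, ∀ x ∈ Y.eigenspace c, g x ∈ Y.eigenspace c := by
      intro g hg x hx
      rw [Module.End.mem_eigenspace_iff] at hx ⊢
      rw [← hcommΓ Y hY g hg, hx, map_smul]
    rcases eq_bot_or_eq_top_of_forall_map_mem hBr hε0 hl1 hspan hgen htrans hstabE with h | h
    · exact absurd h (Module.End.hasEigenvalue_iff.mp hc)
    · exact h
  have hYc : Y = c • (1 : Module.End ℂ W) := by
    ext x
    have hx : x ∈ Y.eigenspace c := by rw [hE]; exact Submodule.mem_top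
    simpa [Module.End.mem_eigenspace_iff] using hx
  have htrY := htr Y hY
  rw [hYc, map_smul, LinearMap.trace_one, smul_eq_mul] at htrY
  rcases mul_eq_zero.1 htrY with h | h
  · rw [hYc, h, zero_smul]
  · exact absurd h (Nat.cast_ne_zero.2 (Module.finrank_pos (R := ℂ) (M := W)).ne')

end Nilpotent

/-! ### §2 `W` is irreducible under any `Ad(Γ)`-stable space of endomorphisms containing a nilpotent -/

section LieIrreducible

variable {W : Type*} [AddCommGroup W] [Module ℂ W] [FiniteDimensional ℂ W]

omit [FiniteDimensional ℂ W] in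
/-- The image of an `L`-stable subspace under `g ∈ Γ` is `L`-stable, for `L` stable under `Ad(g⁻¹)`.
[cite: CarlsonToledo1999, §7 Theorem udensitytheo] -/
theorem forall_mem_map_of_forall_mem {L : Submodule ℂ (Module.End ℂ W)} {g : W ≃ₗ[ℂ] W}
    (hAd : ∀ Y ∈ L, ((g⁻¹ : W ≃ₗ[ℂ] W) : Module.End ℂ W) * Y * (g : Module.End ℂ W) ∈ L)
    {S : Submodule ℂ W} (hS : ∀ Y ∈ L, ∀ x ∈ S, Y x ∈ S) :
    ∀ Y ∈ L, ∀ y ∈ S.map (g : W →ₗ[ℂ] W), Y y ∈ S.map (g : W →ₗ[ℂ] W) := by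
  intro Y hY y hy
  obtain ⟨x, hx, rfl⟩ := Submodule.mem_map.1 hy
  refine Submodule.mem_map.2 ⟨(((g⁻¹ : W ≃ₗ[ℂ] W) : Module.End ℂ W) * Y * (g : Module.End ℂ W)) x,
    hS _ (hAd Y hY) x hx, ?_⟩
  change g (g⁻¹ (Y (g x))) = Y (g x)
  exact linearEquiv_apply_inv_apply g _

/-- **`W` is `L`-irreducible.** For a reflection system (`B` right-separating, roots `B δ δ = ε`,
`ε² = 1`, spanning and `Γ`-transitive, `Γ` generated by the `λ`-reflections, `λ ∉ {0, 1}`) and a subspace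
`L ⊆ End(W)` stable under `Ad(Γ)` which contains a non-zero `N` with `N² = 0`, every `L`-stable subspace
of `W` is `⊥` or `⊤`. Proof: take an `L`-stable `S ≠ 0` of minimal dimension. If `dim S ≥ 2`, then for a
root `δ` the `L`-stable `S ∩ s_δ S` contains `S ∩ δ^⊥ ≠ 0`, so equals `S` by minimality, whence
`s_δ S = S`; thus `S` is `Γ`-stable, `S = W`, and `W` itself is minimal. If `dim S = 1`, `S = ℂw`, then every
`γ w` (`γ ∈ Γ`) spans an `L`-stable line, so `N (γ w) ∈ ℂ γ w` forces `N (γ w) = 0`, and the orbit spans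
`W` — contradiction. [cite: CarlsonToledo1999, §7 Theorem udensitytheo] -/
theorem eq_bot_or_eq_top_of_forall_mem_map_mem {B : W →ₗ⋆[ℂ] W →ₗ[ℂ] ℂ} (hBr : B.SeparatingRight)
    {ε : ℂ} (hε : ε * ε = 1) {l : ℂ} (hl0 : l ≠ 0) (hl1 : l ≠ 1) {Δ : Set W} (hΔ : ∀ δ ∈ Δ, B δ δ = ε)
    (hspan : Submodule.span ℂ Δ = ⊤) {Γ : Subgroup (W ≃ₗ[ℂ] W)}
    (hΓ : Γ = Subgroup.closure {g : W ≃ₗ[ℂ] W | ∃ δ ∈ Δ, (g : W →ₗ[ℂ] W) = complexReflection B ε l δ})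
    (htrans : ∀ δ ∈ Δ, ∀ δ' ∈ Δ, ∃ g ∈ Γ, g δ = δ') {L : Submodule ℂ (Module.End ℂ W)}
    (hAd : ∀ g ∈ Γ, ∀ Y ∈ L, (g : Module.End ℂ W) * Y * ((g⁻¹ : W ≃ₗ[ℂ] W) : Module.End ℂ W) ∈ L)
    {N : Module.End ℂ W} (hNL : N ∈ L) (hN0 : N ≠ 0) (hNN : N * N = 0) {U : Submodule ℂ W}
    (hU : ∀ Y ∈ L, ∀ x ∈ U, Y x ∈ U) : U = ⊥ ∨ U = ⊤ := by
  classical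
  have hε0 : ε ≠ 0 := by rintro rfl; norm_num at hε
  have hgen : ∀ δ ∈ Δ, ∃ g ∈ Γ, (g : W →ₗ[ℂ] W) = complexReflection B ε l δ := fun δ hδ =>
    ⟨complexReflectionEquiv B hε hl0 (hΔ δ hδ), hΓ ▸ Subgroup.subset_closure ⟨δ, hδ, rfl⟩, rfl⟩
  have hAd' : ∀ g ∈ Γ, ∀ Y ∈ L, ((g⁻¹ : W ≃ₗ[ℂ] W) : Module.End ℂ W) * Y * (g : Module.End ℂ W) ∈ L := by
    intro g hg Y hY
    simpa using hAd g⁻¹ (Γ.inv_mem hg) Y hY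
  -- scalar action of `L` on the `Γ`-orbit of a vector spanning an `L`-stable line kills `N`
  have hline : ∀ w : W, w ≠ 0 → (∀ Y ∈ L, ∃ c : ℂ, Y w = c • w) → False := by
    intro w hw0 hw
    -- `N` kills the orbit
    have hNorb : ∀ γ ∈ Γ, N (γ w) = 0 := by
      intro γ hγ
      set Z : Module.End ℂ W := ((γ⁻¹ : W ≃ₗ[ℂ] W) : Module.End ℂ W) * N * (γ : Module.End ℂ W)
      obtain ⟨c, hc⟩ := hw Z (hAd' γ hγ N hNL)
      have hNγ : N (γ w) = c • γ w := by
        have : γ (Z w) = N (γ w) := by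
          change γ (γ⁻¹ (N (γ w))) = _
          exact linearEquiv_apply_inv_apply γ _
        rw [← this, hc, map_smul]
      have h2 : c • (c • γ w) = 0 := by
        have := congrArg (fun f : Module.End ℂ W => f (γ w)) hNN
        simpa [Module.End.mul_apply, hNγ] using this
      rw [smul_smul] at h2
      rcases smul_eq_zero.1 h2 with h | h
      · rw [hNγ, mul_self_eq_zero.1 h, zero_smul]
      · exact absurd h (by simpa using hw0)
    -- the orbit spans `W`
    set V : Submodule ℂ W := Submodule.span ℂ ((fun γ : W ≃ₗ[ℂ] W => γ w) '' (Γ : Set (W ≃ₗ[ℂ] W)))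
    have hV : ∀ g ∈ Γ, ∀ x ∈ V, g x ∈ V := by
      intro g hg x hx
      induction hx using Submodule.span_induction with
      | mem y hy =>
        obtain ⟨γ, hγ, rfl⟩ := hy
        refine Submodule.subset_span ⟨g * γ, Γ.mul_mem hg hγ, ?_⟩
        simp [LinearEquiv.mul_apply]
      | zero => simp
      | add y z _ _ hy hz => rw [map_add]; exact V.add_mem hy hz
      | smul c y _ hy => rw [map_smul]; exact V.smul_mem c hy
    have hVtop : V = ⊤ := by
      rcases eq_bot_or_eq_top_of_forall_map_mem hBr hε0 hl1 hspan hgen htrans hV with h | h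
      · exfalso
        have hwV : w ∈ V := Submodule.subset_span ⟨1, Γ.one_mem, rfl⟩
        rw [h, Submodule.mem_bot] at hwV
        exact hw0 hwV
      · exact h
    apply hN0
    refine LinearMap.ext_on hVtop ?_
    rintro _ ⟨γ, hγ, rfl⟩
    rw [LinearMap.zero_apply]
    exact hNorb γ hγ
  -- main argument
  rcases eq_or_ne U ⊥ with hUbot | hUne
  · exact Or.inl hUbot
  right
  have hex : ∃ m : ℕ, ∃ S : Submodule ℂ W, S ≠ ⊥ ∧ (∀ Y ∈ L, ∀ x ∈ S, Y x ∈ S) ∧ finrank ℂ S = m :=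
    ⟨_, U, hUne, hU, rfl⟩
  obtain ⟨S, hSne, hSL, hSm⟩ := Nat.find_spec hex
  have hmin : ∀ S' : Submodule ℂ W, S' ≠ ⊥ → (∀ Y ∈ L, ∀ x ∈ S', Y x ∈ S') →
      finrank ℂ S ≤ finrank ℂ S' := fun S' h1 h2 => by
    rw [hSm]; exact Nat.find_min' hex ⟨S', h1, h2, rfl⟩
  -- `S = ⊤`
  have hStop : S = ⊤ := by
    by_cases hS1 : finrank ℂ S = 1
    · exfalso
      obtain ⟨⟨w, hwS⟩, hw0, hw⟩ := finrank_eq_one_iff'.1 hS1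
      refine hline w (fun h => hw0 (Subtype.ext h)) fun Y hY => ?_
      obtain ⟨c, hc⟩ := hw ⟨Y w, hSL Y hY w hwS⟩
      exact ⟨c, by simpa using congrArg Subtype.val hc.symm⟩
    -- `dim S ≥ 2`: `S` is `Γ`-stable
    have hS2 : 2 ≤ finrank ℂ S := by
      have h0 : finrank ℂ S ≠ 0 := fun h => hSne (Submodule.finrank_eq_zero.1 h)
      omega
    have hstab : ∀ δ ∈ Δ, ∀ g : W ≃ₗ[ℂ] W, g ∈ Γ → (g : W →ₗ[ℂ] W) = complexReflection B ε l δ →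
        S.map (g : W →ₗ[ℂ] W) = S := by
      intro δ hδ g hgΓ hg
      set S' := S.map (g : W →ₗ[ℂ] W) with hS'
      have hS'L : ∀ Y ∈ L, ∀ y ∈ S', Y y ∈ S' := forall_mem_map_of_forall_mem (hAd' g hgΓ) hSL
      -- `S ⊓ ker (B δ) ≤ S ⊓ S'`
      have hK : S ⊓ LinearMap.ker (B δ) ≤ S ⊓ S' := by
        intro x hx
        obtain ⟨hxS, hxK⟩ := Submodule.mem_inf.1 hx
        refine Submodule.mem_inf.2 ⟨hxS, Submodule.mem_map.2 ⟨x, hxS, ?_⟩⟩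
        rw [LinearMap.mem_ker] at hxK
        change g x = x
        rw [← LinearEquiv.coe_coe, hg, complexReflection_apply_of_orthogonal B ε l hxK]
      -- `S ⊓ ker (B δ) ≠ ⊥` by a dimension count
      have hKne : S ⊓ LinearMap.ker (B δ) ≠ ⊥ := by
        intro h
        have h1 := Submodule.finrank_sup_add_finrank_inf_eq S (LinearMap.ker (B δ))
        rw [h, finrank_bot, add_zero] at h1
        have h2 : finrank ℂ ↥(S ⊔ LinearMap.ker (B δ)) ≤ finrank ℂ W := Submodule.finrank_le _
        have h3 := (B δ).finrank_range_add_finrank_ker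
        have h4 : finrank ℂ (LinearMap.range (B δ)) ≤ 1 := by
          calc finrank ℂ (LinearMap.range (B δ)) ≤ finrank ℂ ℂ := Submodule.finrank_le _
            _ = 1 := Module.finrank_self ℂ
        omega
      have hT : S ⊓ S' = S := by
        refine Submodule.eq_of_le_of_finrank_le inf_le_left (hmin _ ?_ fun Y hY x hx =>
          ⟨hSL Y hY x hx.1, hS'L Y hY x hx.2⟩)
        exact fun h => hKne (le_bot_iff.1 (h ▸ hK))
      have hle : S ≤ S' := fun x hx => (Submodule.mem_inf.1 (hT.symm ▸ hx : x ∈ S ⊓ S')).2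
      refine (Submodule.eq_of_le_of_finrank_le hle ?_).symm
      exact (Submodule.finrank_map_le _ _).trans le_rfl
    have hΓS : ∀ γ ∈ Γ, (∀ x ∈ S, γ x ∈ S) ∧ ∀ x ∈ S, γ⁻¹ x ∈ S := by
      intro γ hγ
      rw [hΓ] at hγ
      induction hγ using Subgroup.closure_induction with
      | mem g hg =>
        obtain ⟨δ, hδ, hgδ⟩ := hg
        have hgΓ : g ∈ Γ := hΓ ▸ Subgroup.subset_closure ⟨δ, hδ, hgδ⟩
        have hmap := hstab δ hδ g hgΓ hgδ
        refine ⟨fun x hx => hmap ▸ Submodule.mem_map_of_mem hx, fun x hx => ?_⟩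
        rw [← hmap] at hx
        obtain ⟨y, hy, hyx⟩ := Submodule.mem_map.1 hx
        have hginv : g⁻¹ x = y := by rw [← hyx]; exact linearEquiv_inv_apply_apply g y
        rw [hginv]; exact hy
      | one => exact ⟨fun x hx => hx, fun x hx => hx⟩
      | mul g h _ _ hg hh =>
        refine ⟨fun x hx => ?_, fun x hx => ?_⟩
        · rw [LinearEquiv.mul_apply]; exact hg.1 _ (hh.1 x hx)
        · rw [mul_inv_rev, LinearEquiv.mul_apply]; exact hh.2 _ (hg.2 x hx)
      | inv g _ hg => exact ⟨hg.2, by simpa using hg.1⟩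
    rcases eq_bot_or_eq_top_of_forall_map_mem hBr hε0 hl1 hspan hgen htrans
      (U := S) (fun g hg x hx => (hΓS g hg).1 x hx) with h | h
    · exact absurd h hSne
    · exact h
  -- conclude
  have hUW : finrank ℂ W ≤ finrank ℂ U := by
    have := hmin U hUne hU
    rwa [hStop, finrank_top] at this
  exact Submodule.eq_top_of_finrank_eq (le_antisymm (Submodule.finrank_le U) hUW)

end LieIrreducible

end Literature.AlgebraicGeometry.HodgeTheory
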